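import Literature.Topology.FourManifolds.CappellShanesonClassGroupFifteen
import Literature.Topology.FourManifolds.CappellShanesonIdealCertificates
import HarnessLib

/-!
# The class group of the trace `16` field (discriminant `32009`, prime) and Gompf's conjecture
# for the traces `16` and `-11` (Kim–Yamada 2023, Theorem B)

Serves the named fact
`Literature.Topology.FourManifolds.kimYamada2023_nonempty_diffeomorph_sphere_four_of_trace_mem_Icc`
(`CappellShaneson.lean`; M. H. Kim, S. Yamada, Kyungpook Math. J. 63 (2023) 373–411 =
arXiv:1707.03860, Cor. C), reduced in the tree to Gompf's topological leaves and Theorem B in matrix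
form (`GompfConjectureForTrace n`) for the traces not yet proved. Like its siblings for the traces
`12`, `14`, `15`, this file PROVES Theorem B for the trace `16` — `C(ℤ[Θ₁₆])` is covered by the
representatives `(1, 1, 16)`, `(2, 3, 16)`, `(4, 7, 16)`, which move by Gompf moves to the traces
`16`, `10 = 16 - 2·3`, `9 = 16 - 7` (Lemma 6.1 / §6.1), where Gompf's conjecture holds — and, by
Theorem A, for `-11 = 5 - 16`. Here the class group has order `3` (at most; the classes `[𝔭₃]`,
`[𝔭₃]² = [𝔭₇]`), the first such case.

## The number theory

For a cubic number field `K` generated by a root `θ` of `f₁₆ = x³ - 16x² + 15x - 1`: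

* `Δ(f₁₆) = 32009` is prime, so `𝓞 K = ℤ[θ]`, `d_K = 32009`, `⌊M_K⌋ ≤ 50`;
* Dedekind–Kummer at `p ≤ 50` (Marcus, Ch. 3, Thm. 27): `2, 5, 13, 17, 23, 29, 37, 43, 47` are
  inert; `f₁₆ ≡ (x - 2)(x² + x + 2) (mod 3)` and `f₁₆ ≡ (x - 4)(x² + 2x + 2) (mod 7)` give
  `𝔭₃ = (3, θ - 2)`, `𝔮₉ = (3, θ² + θ + 2)`, `𝔭₇ = (7, θ - 4)`, `𝔮₄₉ = (7, θ² + 2θ + 2)`; unique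
  roots `10, 4, 28, 10` modulo `11, 19, 31, 41`;
* relations with explicit cofactors: `𝔭₃² = (9, θ - 2)` and `𝔭₃ (9, θ - 2) = (θ - 2)` (norm `27`:
  `θ ≡ 2` is a root of `f₁₆` modulo `27`; certificate lemma `span_pair_mul_span_pair_eq_span_pair`
  of `CappellShanesonIdealCertificates.lean`
  for equalities of two-generated ideals), so `[𝔭₃]³ = 1`; `𝔭₃ 𝔮₉ = (3)`, `𝔭₃ 𝔭₇ = (2θ - 1)`
  (`21`), `𝔭₃ 𝔭₁₁ = (θ + 1)` (`33`), `𝔭₇ 𝔮₄₉ = (7)`, `𝔭₇ 𝔭₁₉ = (θ - 4)` (`133`),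
  `𝔭₇ 𝔭₃₁ = (θ + 3)` (`217`), `𝔭₇ 𝔭₄₁ = (θ² - 6θ + 1)` (`287`);
* hence every ideal class is `1`, `[𝔭₃]` or `[𝔭₇] = [𝔭₃]⁻¹` (`classGroup_mem_triple_sixteen`).

Transport to `ℤ[X]/(f₁₆)` and Prop. 2.14 (`exists_isConj_standardCSMatrix_of_cover`): every
Cappell–Shaneson matrix of trace `16` is similar to `X_{1,1,16} = A₁₄`, `X_{2,3,16}` or `X_{4,7,16}`,
and `gompfConjectureForTrace_sixteen`, `gompfConjectureForTrace_neg_eleven`. No named fact is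
introduced (D-0026).

## References

* [KimYamada2023] M. H. Kim, S. Yamada, Kyungpook Math. J. 63 (2023) 373–411 (arXiv:1707.03860):
  §2.3 (Prop. 2.14), §5 (Table 2), §6.1 (Lemma 6.1 and the proof of Thm. B), Thm. A.
* [Marcus2018] D. A. Marcus, *Number Fields*, 2nd ed., Ch. 3, Thm. 27 (Dedekind–Kummer); Ch. 5,
  Cor. 2 of Thm. 37 (Minkowski bound).
-/

noncomputable section

open Set Polynomial Module NumberField Ideal
open scoped NumberField MatrixGroups nonZeroDivisors
open Literature.LinearAlgebra.Matrix

namespace Literature.Topology.FourManifolds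

section Field

variable {K : Type*} [Field K] [NumberField K] {θ : K}

/-! ### Discriminant `32009` and `𝓞 K = ℤ[θ]` -/

/-- `Δ(f₁₆) = 16·14·13·11 - 23 = 32009`. [cite: KimYamada2023, §3 (Δ(fₙ) = n(n-2)(n-3)(n-5) - 23)] -/
theorem csDisc_sixteen : csDisc 16 = 32009 := by
  decide

set_option maxRecDepth 4096 in
/-- `32009` is prime, so `Δ(f₁₆)` has no factorisation `r² e` with `|e| > 2`, `r ≠ ±1`, and
`𝓞 K = ℤ[θ]`. [folklore] -/
theorem csDisc_sixteen_sq : ∀ r e : ℤ, csDisc 16 = r ^ 2 * e → 2 < |e| → IsUnit r :=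
  isUnit_of_eq_sq_mul (B := 178) (by decide) (by decide) (by decide)

/-- `d_K = 32009` for the trace `16` field. [folklore] -/
theorem discr_eq_sixteen (hθ : aeval θ (csPoly 16) = 0) (h3 : finrank ℚ K = 3) :
    NumberField.discr K = 32009 := by
  rw [discr_eq_csDisc_of_sq hθ h3 csDisc_sixteen_sq, csDisc_sixteen]

/-- The cubic relation `θ³ - 16θ² + 15θ - 1 = 0` in `𝓞 K`. [folklore] -/
theorem thetaInt_rel_sixteen (hθ : aeval θ (csPoly 16) = 0) :
    (thetaInt hθ) ^ 3 - 16 * (thetaInt hθ) ^ 2 + 15 * thetaInt hθ - 1 = 0 := by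
  have rel := thetaInt_rel hθ
  push_cast at rel
  linear_combination rel

/-! ### The primes of norm at most `50` (Dedekind–Kummer) -/

/-- The inert primes `2, 5, 13, 17, 23, 29, 37, 43, 47` (no root of `f₁₆`). [folklore] -/
theorem eq_span_of_inert_sixteen (hθ : aeval θ (csPoly 16) = 0) (h3 : finrank ℚ K = 3) {p : ℕ}
    (hp : p = 2 ∨ p = 5 ∨ p = 13 ∨ p = 17 ∨ p = 23 ∨ p = 29 ∨ p = 37 ∨ p = 43 ∨ p = 47)
    {P : Ideal (𝓞 K)} (hP : P ∈ primesOver (span {(p : ℤ)}) (𝓞 K)) : P = span {(p : 𝓞 K)} := by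
  rcases hp with rfl | rfl | rfl | rfl | rfl | rfl | rfl | rfl | rfl
  · exact eq_span_of_no_root_of_sq hθ h3 csDisc_sixteen_sq (by norm_num) hP (by decide)
  · exact eq_span_of_no_root_of_sq hθ h3 csDisc_sixteen_sq (by norm_num) hP (by decide)
  · exact eq_span_of_no_root_of_sq hθ h3 csDisc_sixteen_sq (by norm_num) hP (by decide)
  · exact eq_span_of_no_root_of_sq hθ h3 csDisc_sixteen_sq (by norm_num) hP (by decide)
  · exact eq_span_of_no_root_of_sq hθ h3 csDisc_sixteen_sq (by norm_num) hP (by decide)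
  · exact eq_span_of_no_root_of_sq hθ h3 csDisc_sixteen_sq (by norm_num) hP (by decide)
  · exact eq_span_of_no_root_of_sq hθ h3 csDisc_sixteen_sq (by norm_num) hP (by decide)
  · exact eq_span_of_no_root_of_sq hθ h3 csDisc_sixteen_sq (by norm_num) hP (by decide)
  · exact eq_span_of_no_root_of_sq hθ h3 csDisc_sixteen_sq (by norm_num) hP (by decide)

/-- The degree-one primes with a unique root: `(11, θ - 10)`, `(19, θ - 4)`, `(31, θ - 28)`,
`(41, θ - 10)` are the only primes `P` above `p = 11, 19, 31, 41` with `p ^ {f_P} ≤ 50`. [folklore] -/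
theorem eq_span_pair_of_unique_root_sixteen (hθ : aeval θ (csPoly 16) = 0) (h3 : finrank ℚ K = 3)
    {p : ℕ} {c₀ : ℤ}
    (hp : (p = 11 ∧ c₀ = 10) ∨ (p = 19 ∧ c₀ = 4) ∨ (p = 31 ∧ c₀ = 28) ∨ (p = 41 ∧ c₀ = 10))
    {P : Ideal (𝓞 K)} (hP : P ∈ primesOver (span {(p : ℤ)}) (𝓞 K)) (hle : p ^ P.inertiaDeg ℤ ≤ 50) :
    P = span {(p : 𝓞 K), thetaInt hθ - (c₀ : 𝓞 K)} := by
  rcases hp with ⟨rfl, rfl⟩ | ⟨rfl, rfl⟩ | ⟨rfl, rfl⟩ | ⟨rfl, rfl⟩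
  · exact eq_span_pair_of_unique_root_of_sq hθ h3 csDisc_sixteen_sq (by norm_num) hP hle
      (by decide) (by norm_num)
  · exact eq_span_pair_of_unique_root_of_sq hθ h3 csDisc_sixteen_sq (by norm_num) hP hle
      (by decide) (by norm_num)
  · exact eq_span_pair_of_unique_root_of_sq hθ h3 csDisc_sixteen_sq (by norm_num) hP hle
      (by decide) (by norm_num)
  · exact eq_span_pair_of_unique_root_of_sq hθ h3 csDisc_sixteen_sq (by norm_num) hP hle
      (by decide) (by norm_num)

/-- `f₁₆ = (x - 2)(x² + x + 2) + 3(-5x² + 5x + 1)`: `f₁₆ ≡ (x - 2)(x² + x + 2) (mod 3)`. [folklore] -/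
theorem csPoly_sixteen_eq_three :
    csPoly 16 = (X - 2) * (X ^ 2 + X + 2) + 3 * (-5 * X ^ 2 + 5 * X + 1) := by
  simp only [csPoly, map_sub, map_one, map_ofNat]
  ring

/-- The lift `x² + x + 2` reduces to `x² + x + 2 ∈ 𝔽₃[x]`. [folklore] -/
theorem map_quad_sixteen_three :
    (X ^ 2 + X + 2 : ℤ[X]).map (Int.castRingHom (ZMod 3)) = X ^ 2 + X + 2 := by
  simp only [Polynomial.map_add, Polynomial.map_pow, map_X, Polynomial.map_ofNat]

/-- `f₁₆ mod 3 = (x - 2)(x² + x + 2)`. [folklore] -/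
theorem csPolyMod_sixteen_three :
    csPolyMod 16 3 = (X - C ((2 : ℤ) : ZMod 3)) *
      (X ^ 2 + X + 2 : ℤ[X]).map (Int.castRingHom (ZMod 3)) := by
  rw [csPolyMod, csPoly_sixteen_eq_three, Polynomial.map_add]
  have h3 : Polynomial.map (Int.castRingHom (ZMod 3)) (3 * (-5 * X ^ 2 + 5 * X + 1) : ℤ[X]) = 0 := by
    rw [Polynomial.map_mul, show (3 : ℤ[X]) = C 3 from rfl, Polynomial.map_C]
    have : (Int.castRingHom (ZMod 3)) 3 = 0 := by decide
    rw [this, C_0, zero_mul]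
  rw [h3, add_zero, map_quad_sixteen_three]
  simp only [Polynomial.map_mul, Polynomial.map_sub, Polynomial.map_add, Polynomial.map_pow, map_X,
    Polynomial.map_ofNat, Int.cast_ofNat, map_ofNat]

/-- `x² + x + 2` is monic over `𝔽₃`. [folklore] -/
theorem monic_quad_sixteen_three :
    ((X ^ 2 + X + 2 : ℤ[X]).map (Int.castRingHom (ZMod 3))).Monic := by
  rw [map_quad_sixteen_three]
  monicity!

/-- `x² + x + 2` has no root modulo `3`. [folklore] -/
theorem quad_sixteen_three_ne_zero : ∀ c : ZMod 3, c ^ 2 + c + 2 ≠ 0 := by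
  decide

/-- `x² + x + 2` is irreducible over `𝔽₃`. [folklore] -/
theorem irreducible_quad_sixteen_three :
    Irreducible ((X ^ 2 + X + 2 : ℤ[X]).map (Int.castRingHom (ZMod 3))) := by
  haveI := Fact.mk Nat.prime_three
  rw [map_quad_sixteen_three]
  have hdeg : (X ^ 2 + X + 2 : (ZMod 3)[X]).natDegree = 2 := by compute_degree!
  refine irreducible_of_degree_le_three_of_not_isRoot (by rw [hdeg]; decide) fun c hc =>
    quad_sixteen_three_ne_zero c ?_
  have h := hc
  rw [IsRoot.def] at h
  simpa using h

/-- **The primes above `3`**: `𝔭₃ = (3, θ - 2)` and `𝔮₉ = (3, θ² + θ + 2)`. [folklore] -/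
theorem eq_P3_or_eq_Q3_sixteen (hθ : aeval θ (csPoly 16) = 0) (h3 : finrank ℚ K = 3)
    {P : Ideal (𝓞 K)} (hP : P ∈ primesOver (span {((3 : ℕ) : ℤ)}) (𝓞 K)) :
    P = span {(3 : 𝓞 K), thetaInt hθ - 2} ∨
      P = span {(3 : 𝓞 K), (thetaInt hθ) ^ 2 + thetaInt hθ + 2} := by
  rcases eq_span_pair_of_linear_mul_quadratic_of_sq hθ h3 csDisc_sixteen_sq Nat.prime_three
    monic_quad_sixteen_three irreducible_quad_sixteen_three csPolyMod_sixteen_three hP with h | h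
  · left; simpa using h
  · right
    simp only [map_add, map_pow, aeval_X, map_ofNat] at h
    simpa using h

/-- `f₁₆ = (x - 4)(x² + 2x + 2) + 7(-2x² + 3x + 1)`: `f₁₆ ≡ (x - 4)(x² + 2x + 2) (mod 7)`. [folklore] -/
theorem csPoly_sixteen_eq_seven :
    csPoly 16 = (X - 4) * (X ^ 2 + 2 * X + 2) + 7 * (-2 * X ^ 2 + 3 * X + 1) := by
  simp only [csPoly, map_sub, map_one, map_ofNat]
  ring

/-- The lift `x² + 2x + 2` reduces to `x² + 2x + 2 ∈ 𝔽₇[x]`. [folklore] -/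
theorem map_quad_sixteen_seven :
    (X ^ 2 + 2 * X + 2 : ℤ[X]).map (Int.castRingHom (ZMod 7)) = X ^ 2 + 2 * X + 2 := by
  simp only [Polynomial.map_add, Polynomial.map_mul, Polynomial.map_pow, map_X, Polynomial.map_ofNat]

/-- `f₁₆ mod 7 = (x - 4)(x² + 2x + 2)`. [folklore] -/
theorem csPolyMod_sixteen_seven :
    csPolyMod 16 7 = (X - C ((4 : ℤ) : ZMod 7)) *
      (X ^ 2 + 2 * X + 2 : ℤ[X]).map (Int.castRingHom (ZMod 7)) := by
  rw [csPolyMod, csPoly_sixteen_eq_seven, Polynomial.map_add]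
  have h7 : Polynomial.map (Int.castRingHom (ZMod 7)) (7 * (-2 * X ^ 2 + 3 * X + 1) : ℤ[X]) = 0 := by
    rw [Polynomial.map_mul, show (7 : ℤ[X]) = C 7 from rfl, Polynomial.map_C]
    have : (Int.castRingHom (ZMod 7)) 7 = 0 := by decide
    rw [this, C_0, zero_mul]
  rw [h7, add_zero, map_quad_sixteen_seven]
  simp only [Polynomial.map_mul, Polynomial.map_sub, Polynomial.map_add, Polynomial.map_pow, map_X,
    Polynomial.map_ofNat, Int.cast_ofNat, map_ofNat]

/-- `x² + 2x + 2` is monic over `𝔽₇`. [folklore] -/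
theorem monic_quad_sixteen_seven :
    ((X ^ 2 + 2 * X + 2 : ℤ[X]).map (Int.castRingHom (ZMod 7))).Monic := by
  rw [map_quad_sixteen_seven]
  monicity!

/-- `x² + 2x + 2` has no root modulo `7`. [folklore] -/
theorem quad_sixteen_seven_ne_zero : ∀ c : ZMod 7, c ^ 2 + 2 * c + 2 ≠ 0 := by
  decide

/-- `x² + 2x + 2` is irreducible over `𝔽₇`. [folklore] -/
theorem irreducible_quad_sixteen_seven :
    Irreducible ((X ^ 2 + 2 * X + 2 : ℤ[X]).map (Int.castRingHom (ZMod 7))) := by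
  haveI := Fact.mk (show Nat.Prime 7 by norm_num)
  rw [map_quad_sixteen_seven]
  have hdeg : (X ^ 2 + 2 * X + 2 : (ZMod 7)[X]).natDegree = 2 := by compute_degree!
  refine irreducible_of_degree_le_three_of_not_isRoot (by rw [hdeg]; decide) fun c hc =>
    quad_sixteen_seven_ne_zero c ?_
  have h := hc
  rw [IsRoot.def] at h
  simpa using h

/-- **The primes above `7`**: `𝔭₇ = (7, θ - 4)` and `𝔮₄₉ = (7, θ² + 2θ + 2)`. [folklore] -/
theorem eq_P7_or_eq_Q7_sixteen (hθ : aeval θ (csPoly 16) = 0) (h3 : finrank ℚ K = 3)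
    {P : Ideal (𝓞 K)} (hP : P ∈ primesOver (span {((7 : ℕ) : ℤ)}) (𝓞 K)) :
    P = span {(7 : 𝓞 K), thetaInt hθ - 4} ∨
      P = span {(7 : 𝓞 K), (thetaInt hθ) ^ 2 + 2 * thetaInt hθ + 2} := by
  rcases eq_span_pair_of_linear_mul_quadratic_of_sq hθ h3 csDisc_sixteen_sq (by norm_num)
    monic_quad_sixteen_seven irreducible_quad_sixteen_seven csPolyMod_sixteen_seven hP with h | h
  · left; simpa using h
  · right
    simp only [map_add, map_mul, map_pow, aeval_X, map_ofNat] at h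
    simpa using h

/-! ### Relations among the small primes: explicit generators -/

/-- **`𝔭₃² = (9, θ - 2)`** (`2` is a root of `f₁₆` modulo `27`): `θ - 2 = (θ - 12)(θ - 2)² - 12·3(θ - 2) - 3·9`. [folklore] -/
theorem P3_mul_P3_sixteen (hθ : aeval θ (csPoly 16) = 0) :
    span {(3 : 𝓞 K), thetaInt hθ - 2} * span {(3 : 𝓞 K), thetaInt hθ - 2} =
      span {(9 : 𝓞 K), thetaInt hθ - 2} := by
  have rel := thetaInt_rel_sixteen hθ
  set t := thetaInt hθ with ht
  exact span_pair_mul_span_pair_eq_span_pair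
    (α₁ := 1) (β₁ := 0)
    (α₂ := 0) (β₂ := 3)
    (α₃ := 0) (β₃ := 3)
    (α₄ := 0) (β₄ := t - 2)
    (u₁ := 1) (u₂ := 0) (u₃ := 0) (u₄ := 0)
    (v₁ := -3) (v₂ := -12) (v₃ := 0) (v₄ := t - 12)
    (by ring) (by ring) (by ring) (by ring)
    (by ring) (by linear_combination (-1 : 𝓞 K) * rel)

/-- **`𝔭₃ · (9, θ - 2) = (θ - 2)`** (`N(θ - 2) = 27`; `θ - 2 = (θ - 12)(θ - 2)² - 12·3(θ - 2) - 27`): with `𝔭₃² = (9, θ - 2)` this gives `[𝔭₃]³ = 1`. [folklore] -/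
theorem P3_mul_P9_sixteen (hθ : aeval θ (csPoly 16) = 0) :
    span {(3 : 𝓞 K), thetaInt hθ - 2} * span {(9 : 𝓞 K), thetaInt hθ - 2} =
      span {thetaInt hθ - 2} := by
  have rel := thetaInt_rel_sixteen hθ
  set t := thetaInt hθ with ht
  exact span_pair_mul_span_pair_eq_span_singleton
    (δ₁ := t ^ 2 - 14 * t - 13) (δ₂ := 3)
    (δ₃ := 9) (δ₄ := t - 2)
    (u₁ := -1) (u₂ := -12) (u₃ := 0) (u₄ := t - 12)
    (by linear_combination (-1 : 𝓞 K) * rel) (by ring)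
    (by ring) (by ring)
    (by linear_combination (-1 : 𝓞 K) * rel)

/-- **`𝔭₃ 𝔮₉ = (3)`**, `𝔮₉ = (3, θ² + θ + 2)` the prime of degree two above `3` (`f₁₆ ≡ (x - 2)(x² + x + 2) (mod 3)`). [folklore] -/
theorem P3_mul_Q3_sixteen (hθ : aeval θ (csPoly 16) = 0) :
    span {(3 : 𝓞 K), thetaInt hθ - 2} * span {(3 : 𝓞 K), thetaInt hθ ^ 2 + thetaInt hθ + 2} =
      span {3} := by
  have rel := thetaInt_rel_sixteen hθ
  set t := thetaInt hθ with ht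
  exact span_pair_mul_span_pair_eq_span_singleton
    (δ₁ := 3) (δ₂ := t ^ 2 + t + 2)
    (δ₃ := t - 2) (δ₄ := 5 * t ^ 2 - 5 * t - 1)
    (u₁ := -10) (u₂ := 5) (u₃ := -10) (u₄ := -1)
    (by ring) (by ring)
    (by ring) (by linear_combination (1 : 𝓞 K) * rel)
    (by linear_combination (1 : 𝓞 K) * rel)

/-- **`𝔭₃ 𝔭₇ = (2θ - 1)`** (`N = -21`). [folklore] -/
theorem P3_mul_P7_sixteen (hθ : aeval θ (csPoly 16) = 0) :
    span {(3 : 𝓞 K), thetaInt hθ - 2} * span {(7 : 𝓞 K), thetaInt hθ - 4} =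
      span {2 * thetaInt hθ - 1} := by
  have rel := thetaInt_rel_sixteen hθ
  set t := thetaInt hθ with ht
  exact span_pair_mul_span_pair_eq_span_singleton
    (δ₁ := -4 * t ^ 2 + 62 * t - 29) (δ₂ := 2 * t ^ 2 - 31 * t + 16)
    (δ₃ := 2 * t ^ 2 - 31 * t + 18) (δ₄ := -t ^ 2 + 16 * t - 10)
    (u₁ := 1) (u₂ := 3) (u₃ := -1) (u₄ := 0)
    (by linear_combination (8 : 𝓞 K) * rel) (by linear_combination (-4 : 𝓞 K) * rel)
    (by linear_combination (-4 : 𝓞 K) * rel) (by linear_combination (2 : 𝓞 K) * rel)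
    (by ring)

/-- **`𝔭₃ 𝔭₁₁ = (θ + 1)`** (`N = 33`). [folklore] -/
theorem P3_mul_P11_sixteen (hθ : aeval θ (csPoly 16) = 0) :
    span {(3 : 𝓞 K), thetaInt hθ - 2} * span {(11 : 𝓞 K), thetaInt hθ - 10} =
      span {thetaInt hθ + 1} := by
  have rel := thetaInt_rel_sixteen hθ
  set t := thetaInt hθ with ht
  exact span_pair_mul_span_pair_eq_span_singleton
    (δ₁ := t ^ 2 - 17 * t + 32) (δ₂ := -t ^ 2 + 17 * t - 29)
    (δ₃ := -t ^ 2 + 17 * t - 21) (δ₄ := t ^ 2 - 16 * t + 19)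
    (u₁ := 3) (u₂ := 4) (u₃ := -1) (u₄ := 0)
    (by linear_combination (-1 : 𝓞 K) * rel) (by linear_combination (1 : 𝓞 K) * rel)
    (by linear_combination (1 : 𝓞 K) * rel) (by linear_combination (-1 : 𝓞 K) * rel)
    (by ring)

/-- **`𝔭₇ 𝔮₄₉ = (7)`**, `𝔮₄₉ = (7, θ² + 2θ + 2)` the prime of degree two above `7` (`f₁₆ ≡ (x - 4)(x² + 2x + 2) (mod 7)`). [folklore] -/
theorem P7_mul_Q7_sixteen (hθ : aeval θ (csPoly 16) = 0) :
    span {(7 : 𝓞 K), thetaInt hθ - 4} * span {(7 : 𝓞 K), thetaInt hθ ^ 2 + 2 * thetaInt hθ + 2} =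
      span {7} := by
  have rel := thetaInt_rel_sixteen hθ
  set t := thetaInt hθ with ht
  exact span_pair_mul_span_pair_eq_span_singleton
    (δ₁ := 7) (δ₂ := t ^ 2 + 2 * t + 2)
    (δ₃ := t - 4) (δ₄ := 2 * t ^ 2 - 3 * t - 1)
    (u₁ := -14) (u₂ := 6) (u₃ := -21) (u₄ := -3)
    (by ring) (by ring)
    (by ring) (by linear_combination (1 : 𝓞 K) * rel)
    (by linear_combination (3 : 𝓞 K) * rel)

/-- **`𝔭₇ 𝔭₁₉ = (θ - 4)`** (`N = 133`). [folklore] -/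
theorem P7_mul_P19_sixteen (hθ : aeval θ (csPoly 16) = 0) :
    span {(7 : 𝓞 K), thetaInt hθ - 4} * span {(19 : 𝓞 K), thetaInt hθ - 4} =
      span {thetaInt hθ - 4} := by
  have rel := thetaInt_rel_sixteen hθ
  set t := thetaInt hθ with ht
  exact span_pair_mul_span_pair_eq_span_singleton
    (δ₁ := t ^ 2 - 12 * t - 33) (δ₂ := 7)
    (δ₃ := 19) (δ₄ := t - 4)
    (u₁ := 0) (u₂ := -8) (u₃ := 3) (u₄ := 0)
    (by linear_combination (-1 : 𝓞 K) * rel) (by ring)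
    (by ring) (by ring)
    (by ring)

/-- **`𝔭₇ 𝔭₃₁ = (θ + 3)`** (`N = 217`). [folklore] -/
theorem P7_mul_P31_sixteen (hθ : aeval θ (csPoly 16) = 0) :
    span {(7 : 𝓞 K), thetaInt hθ - 4} * span {(31 : 𝓞 K), thetaInt hθ - 28} =
      span {thetaInt hθ + 3} := by
  have rel := thetaInt_rel_sixteen hθ
  set t := thetaInt hθ with ht
  exact span_pair_mul_span_pair_eq_span_singleton
    (δ₁ := t ^ 2 - 19 * t + 72) (δ₂ := -t ^ 2 + 19 * t - 65)
    (δ₃ := -t ^ 2 + 19 * t - 41) (δ₄ := t ^ 2 - 18 * t + 37)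
    (u₁ := 7) (u₂ := 9) (u₃ := -2) (u₄ := 0)
    (by linear_combination (-1 : 𝓞 K) * rel) (by linear_combination (1 : 𝓞 K) * rel)
    (by linear_combination (1 : 𝓞 K) * rel) (by linear_combination (-1 : 𝓞 K) * rel)
    (by ring)

/-- **`𝔭₇ 𝔭₄₁ = (θ² - 6θ + 1)`** (`N = -287`). [folklore] -/
theorem P7_mul_P41_sixteen (hθ : aeval θ (csPoly 16) = 0) :
    span {(7 : 𝓞 K), thetaInt hθ - 4} * span {(41 : 𝓞 K), thetaInt hθ - 10} =
      span {thetaInt hθ ^ 2 - 6 * thetaInt hθ + 1} := by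
  have rel := thetaInt_rel_sixteen hθ
  set t := thetaInt hθ with ht
  exact span_pair_mul_span_pair_eq_span_singleton
    (δ₁ := 46 * t ^ 2 - 727 * t + 554) (δ₂ := -11 * t ^ 2 + 174 * t - 134)
    (δ₃ := -25 * t ^ 2 + 396 * t - 310) (δ₄ := 6 * t ^ 2 - 95 * t + 75)
    (u₁ := 1) (u₂ := 7) (u₃ := -1) (u₄ := 1)
    (by linear_combination (-46 * t + 267) * rel) (by linear_combination (11 * t - 64) * rel)
    (by linear_combination (25 * t - 146) * rel) (by linear_combination (-6 * t + 35) * rel)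
    (by ring)

/-! ### Every ideal class is `1`, `[𝔭₃]` or `[𝔭₇] = [𝔭₃]²` -/

/-- `𝔭₃ = (3, θ - 2)` is a nonzero ideal. [folklore] -/
theorem P3_mem_nonZeroDivisors_sixteen (hθ : aeval θ (csPoly 16) = 0) :
    span {(3 : 𝓞 K), thetaInt hθ - 2} ∈ (Ideal (𝓞 K))⁰ := by
  have h := span_pair_natCast_mem_nonZeroDivisors (K := K) (n := 3) (Nat.succ_ne_zero 2)
    (thetaInt hθ - 2)
  simp only [Nat.cast_ofNat] at h
  exact h

/-- `𝔭₇ = (7, θ - 4)` is a nonzero ideal. [folklore] -/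
theorem P7_mem_nonZeroDivisors_sixteen (hθ : aeval θ (csPoly 16) = 0) :
    span {(7 : 𝓞 K), thetaInt hθ - 4} ∈ (Ideal (𝓞 K))⁰ := by
  have h := span_pair_natCast_mem_nonZeroDivisors (K := K) (n := 7) (Nat.succ_ne_zero 6)
    (thetaInt hθ - 4)
  simp only [Nat.cast_ofNat] at h
  exact h

/-- **Every ideal class of the trace `16` field is `1`, `[𝔭₃]` or `[𝔭₇]`, with `[𝔭₃]³ = 1` and
`[𝔭₇] = [𝔭₃]⁻¹`** (class number `≤ 3`). Proof: `d_K = 32009`, `⌊M_K⌋ ≤ 50`; Dedekind–Kummer at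
`p ≤ 50` and the relations `𝔭₃² = (9, θ - 2)`, `𝔭₃ (9, θ - 2) = (θ - 2)`, `𝔭₃ 𝔮₉ = (3)`,
`𝔭₃ 𝔭₇ = (2θ - 1)`, `𝔭₃ 𝔭₁₁ = (θ + 1)`, `𝔭₇ 𝔮₄₉ = (7)`, `𝔭₇ 𝔭₁₉ = (θ - 4)`, `𝔭₇ 𝔭₃₁ = (θ + 3)`,
`𝔭₇ 𝔭₄₁ = (θ² - 6θ + 1)`. [cite: KimYamada2023, §6.1 (proof of Thm. B)] -/
theorem classGroup_mem_triple_sixteen (hθ : aeval θ (csPoly 16) = 0) (h3 : finrank ℚ K = 3)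
    (C : ClassGroup (𝓞 K)) :
    C = 1 ∨ C = ClassGroup.mk0 ⟨span {(3 : 𝓞 K), thetaInt hθ - 2}, P3_mem_nonZeroDivisors_sixteen hθ⟩ ∨
      C = ClassGroup.mk0 ⟨span {(7 : 𝓞 K), thetaInt hθ - 4}, P7_mem_nonZeroDivisors_sixteen hθ⟩ := by
  classical
  set c3 : ClassGroup (𝓞 K) :=
    ClassGroup.mk0 ⟨span {(3 : 𝓞 K), thetaInt hθ - 2}, P3_mem_nonZeroDivisors_sixteen hθ⟩ with hc3
  have rel := thetaInt_rel_sixteen hθ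
  set t := thetaInt hθ with ht
  have hne : ∀ (x y : 𝓞 K) (n : ℕ), x * y = n → n ≠ 0 → x ≠ 0 := by
    rintro x y n hxy hn rfl
    rw [zero_mul] at hxy
    exact hn (by exact_mod_cast hxy.symm)
  have hne1 : t - 2 ≠ 0 :=
    hne _ (t ^ 2 - 14 * t - 13) 27 (by push_cast; linear_combination (1 : 𝓞 K) * rel)
      (by norm_num)
  have hne2 : 2 * t - 1 ≠ 0 :=
    hne _ (-4 * t ^ 2 + 62 * t - 29) 21 (by push_cast; linear_combination (-8 : 𝓞 K) * rel)
      (by norm_num)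
  have hne3 : t + 1 ≠ 0 :=
    hne _ (t ^ 2 - 17 * t + 32) 33 (by push_cast; linear_combination (1 : 𝓞 K) * rel)
      (by norm_num)
  have hne4 : t - 4 ≠ 0 :=
    hne _ (t ^ 2 - 12 * t - 33) 133 (by push_cast; linear_combination (1 : 𝓞 K) * rel)
      (by norm_num)
  have hne5 : t + 3 ≠ 0 :=
    hne _ (t ^ 2 - 19 * t + 72) 217 (by push_cast; linear_combination (1 : 𝓞 K) * rel)
      (by norm_num)
  have hne6 : t ^ 2 - 6 * t + 1 ≠ 0 :=
    hne _ (46 * t ^ 2 - 727 * t + 554) 287 (by push_cast; linear_combination (46 * t - 267) * rel)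
      (by norm_num)
  let H : Subgroup (ClassGroup (𝓞 K)) := Subgroup.zpowers c3
  have hc3H : c3 ∈ H := Subgroup.mem_zpowers c3
  have hinv : ∀ (P Q : Ideal (𝓞 K)) (hP0 : P ∈ (Ideal (𝓞 K))⁰) (hQ0 : Q ∈ (Ideal (𝓞 K))⁰) (x : 𝓞 K),
      x ≠ 0 → P * Q = span {x} → ClassGroup.mk0 ⟨P, hP0⟩ = (ClassGroup.mk0 ⟨Q, hQ0⟩)⁻¹ := by
    intro P Q hP0 hQ0 x hx hPQ
    exact ClassGroup.mk0_eq_mk0_inv_iff.mpr ⟨x, hx, by simpa using hPQ⟩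
  have hprinc : ∀ (P : Ideal (𝓞 K)) (hP0 : P ∈ (Ideal (𝓞 K))⁰) (x : 𝓞 K), P = span {x} →
      ClassGroup.mk0 ⟨P, hP0⟩ ∈ H := by
    intro P hP0 x hPx
    have : ClassGroup.mk0 ⟨P, hP0⟩ = 1 :=
      (ClassGroup.mk0_eq_one_iff hP0).mpr ⟨⟨x, by rw [hPx, submodule_span_eq]⟩⟩
    rw [this]
    exact H.one_mem
  have hnz : ∀ (n : ℕ) (hn : n ≠ 0) (x : 𝓞 K), span {(n : 𝓞 K), x} ∈ (Ideal (𝓞 K))⁰ :=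
    fun n hn x => span_pair_natCast_mem_nonZeroDivisors (K := K) hn x
  have hP3 : span {(3 : 𝓞 K), t - 2} ∈ (Ideal (𝓞 K))⁰ := P3_mem_nonZeroDivisors_sixteen hθ
  have hP7 : span {(7 : 𝓞 K), t - 4} ∈ (Ideal (𝓞 K))⁰ := P7_mem_nonZeroDivisors_sixteen hθ
  have hP9 : span {(9 : 𝓞 K), t - 2} ∈ (Ideal (𝓞 K))⁰ := by
    have h := hnz 9 (by norm_num) (t - 2)
    simp only [Nat.cast_ofNat] at h
    exact h
  -- `[𝔭₇] = [𝔭₃]⁻¹`, `[𝔭₃]² = [(9, θ - 2)] = [𝔭₃]⁻¹`, so `[𝔭₃]³ = 1`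
  have h7cls : ClassGroup.mk0 ⟨span {(7 : 𝓞 K), t - 4}, hP7⟩ = c3⁻¹ :=
    hinv _ _ hP7 hP3 _ hne2 (by rw [mul_comm]; exact P3_mul_P7_sixteen hθ)
  have h9cls : ClassGroup.mk0 ⟨span {(9 : 𝓞 K), t - 2}, hP9⟩ = c3⁻¹ :=
    hinv _ _ hP9 hP3 _ hne1 (by rw [mul_comm]; exact P3_mul_P9_sixteen hθ)
  have hsq : c3 * c3 = c3⁻¹ := by
    rw [← h9cls, hc3, ← map_mul]
    congr 1
    exact Subtype.ext (by simpa using P3_mul_P3_sixteen hθ)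
  have hcube : c3 ^ (3 : ℤ) = 1 := by
    rw [show (3 : ℤ) = 2 + 1 by norm_num, zpow_add, zpow_two, zpow_one, hsq, inv_mul_cancel]
  -- Minkowski: `⌊M_K⌋ ≤ 50`
  have hd : ((|NumberField.discr K| : ℤ) : ℝ) ≤ (32009 : ℕ) := by
    rw [discr_eq_sixteen hθ h3]
    norm_num
  have hfloor := floor_minkowskiBound_le_cubic h3 hd (s := 179) (U := 50) (by norm_num)
    (by norm_num) (by norm_num)
  have htop : H = ⊤ := by
    refine classGroup_subgroup_eq_top_of_primesOver H hfloor fun p hp hprime P hP0 hP hle => ?_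
    have hpU : p ≤ 50 := (Finset.mem_Icc.mp hp).2
    have h1p : 1 ≤ p := (Finset.mem_Icc.mp hp).1
    interval_cases p
    · exact absurd hprime (by decide)
    · exact hprinc P hP0 _ (eq_span_of_inert_sixteen hθ h3 (by norm_num) hP)
    · -- `p = 3`
      rcases eq_P3_or_eq_Q3_sixteen hθ h3 hP with h | h <;> subst h
      · exact hc3H
      · rw [hinv _ _ hP0 hP3 3 (by norm_num) (by rw [mul_comm]; exact P3_mul_Q3_sixteen hθ)]
        exact H.inv_mem hc3H
    · exact absurd hprime (by decide)
    · exact hprinc P hP0 _ (eq_span_of_inert_sixteen hθ h3 (by norm_num) hP)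
    · exact absurd hprime (by decide)
    · -- `p = 7`
      rcases eq_P7_or_eq_Q7_sixteen hθ h3 hP with h | h <;> subst h
      · rw [h7cls]
        exact H.inv_mem hc3H
      · rw [hinv _ _ hP0 hP7 7 (by norm_num) (by rw [mul_comm]; exact P7_mul_Q7_sixteen hθ), h7cls,
          inv_inv]
        exact hc3H
    · exact absurd hprime (by decide)
    · exact absurd hprime (by decide)
    · exact absurd hprime (by decide)
    · -- `p = 11`
      have h := eq_span_pair_of_unique_root_sixteen hθ h3 (Or.inl ⟨rfl, rfl⟩) hP hle
      simp only [Nat.cast_ofNat, Int.cast_ofNat] at h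
      subst h
      rw [hinv _ _ hP0 hP3 _ hne3 (by rw [mul_comm]; exact P3_mul_P11_sixteen hθ)]
      exact H.inv_mem hc3H
    · exact absurd hprime (by decide)
    · exact hprinc P hP0 _ (eq_span_of_inert_sixteen hθ h3 (by norm_num) hP)
    · exact absurd hprime (by decide)
    · exact absurd hprime (by decide)
    · exact absurd hprime (by decide)
    · exact hprinc P hP0 _ (eq_span_of_inert_sixteen hθ h3 (by norm_num) hP)
    · exact absurd hprime (by decide)
    · -- `p = 19`
      have h := eq_span_pair_of_unique_root_sixteen hθ h3 (Or.inr (Or.inl ⟨rfl, rfl⟩)) hP hle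
      simp only [Nat.cast_ofNat, Int.cast_ofNat] at h
      subst h
      rw [hinv _ _ hP0 hP7 _ hne4 (by rw [mul_comm]; exact P7_mul_P19_sixteen hθ), h7cls, inv_inv]
      exact hc3H
    · exact absurd hprime (by decide)
    · exact absurd hprime (by decide)
    · exact absurd hprime (by decide)
    · exact hprinc P hP0 _ (eq_span_of_inert_sixteen hθ h3 (by norm_num) hP)
    · exact absurd hprime (by decide)
    · exact absurd hprime (by decide)
    · exact absurd hprime (by decide)
    · exact absurd hprime (by decide)
    · exact absurd hprime (by decide)
    · exact hprinc P hP0 _ (eq_span_of_inert_sixteen hθ h3 (by norm_num) hP)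
    · exact absurd hprime (by decide)
    · -- `p = 31`
      have h := eq_span_pair_of_unique_root_sixteen hθ h3 (Or.inr (Or.inr (Or.inl ⟨rfl, rfl⟩))) hP hle
      simp only [Nat.cast_ofNat, Int.cast_ofNat] at h
      subst h
      rw [hinv _ _ hP0 hP7 _ hne5 (by rw [mul_comm]; exact P7_mul_P31_sixteen hθ), h7cls, inv_inv]
      exact hc3H
    · exact absurd hprime (by decide)
    · exact absurd hprime (by decide)
    · exact absurd hprime (by decide)
    · exact absurd hprime (by decide)
    · exact absurd hprime (by decide)
    · exact hprinc P hP0 _ (eq_span_of_inert_sixteen hθ h3 (by norm_num) hP)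
    · exact absurd hprime (by decide)
    · exact absurd hprime (by decide)
    · exact absurd hprime (by decide)
    · -- `p = 41`
      have h := eq_span_pair_of_unique_root_sixteen hθ h3 (Or.inr (Or.inr (Or.inr ⟨rfl, rfl⟩))) hP hle
      simp only [Nat.cast_ofNat, Int.cast_ofNat] at h
      subst h
      rw [hinv _ _ hP0 hP7 _ hne6 (by rw [mul_comm]; exact P7_mul_P41_sixteen hθ), h7cls, inv_inv]
      exact hc3H
    · exact absurd hprime (by decide)
    · exact hprinc P hP0 _ (eq_span_of_inert_sixteen hθ h3 (by norm_num) hP)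
    · exact absurd hprime (by decide)
    · exact absurd hprime (by decide)
    · exact absurd hprime (by decide)
    · exact hprinc P hP0 _ (eq_span_of_inert_sixteen hθ h3 (by norm_num) hP)
    · exact absurd hprime (by decide)
    · exact absurd hprime (by decide)
    · exact absurd hprime (by decide)
  have hC : C ∈ H := by rw [htop]; exact Subgroup.mem_top C
  obtain ⟨k, rfl⟩ := Subgroup.mem_zpowers_iff.mp hC
  obtain ⟨q, r, hr, rfl⟩ : ∃ q r : ℤ, (r = 0 ∨ r = 1 ∨ r = 2) ∧ k = 3 * q + r :=
    ⟨k / 3, k % 3, by omega, by omega⟩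
  rw [zpow_add, zpow_mul, hcube, one_zpow, one_mul]
  rcases hr with rfl | rfl | rfl
  · left
    rw [zpow_zero]
  · right; left
    rw [zpow_one]
  · right; right
    rw [zpow_two, hsq, ← h7cls]

end Field

/-! ### The ideal classes of `ℤ[X]/(f₁₆)` and Gompf's conjecture for the traces `16` and `-11` -/

section Matrices

/-- **The ideal classes of `ℤ[Θ₁₆] = ℤ[X]/(f₁₆)`**: every non-zero ideal is in the class of
`⟨Θ - 1, 1⟩`, `⟨Θ - 2, 3⟩` or `⟨Θ - 4, 7⟩` (the representatives `(1, 1, 16)`, `(2, 3, 16)`,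
`(4, 7, 16)` cover `C(ℤ[Θ₁₆])`). [cite: KimYamada2023, §6.1 (proof of Thm. B)] -/
theorem ideal_class_adjoinRoot_sixteen (J : Ideal (AdjoinRoot (csPoly 16))) (hJ : J ≠ ⊥) :
    ∃ x y : AdjoinRoot (csPoly 16), x ≠ 0 ∧ y ≠ 0 ∧
      (span {x} * J = span {y} * csIdeal 1 1 16 ∨ span {x} * J = span {y} * csIdeal 2 3 16 ∨
        span {x} * J = span {y} * csIdeal 4 7 16) := by
  classical
  set θ' := AdjoinRoot.root (csPolyQ 16) with hθ'
  have hθ : aeval θ' (csPoly 16) = 0 := aeval_root_csPoly 16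
  have h3 : finrank ℚ (CSField 16) = 3 := finrank_CSField 16
  obtain ⟨e, he⟩ := exists_ringEquiv_adjoinRoot_of_sq hθ h3 csDisc_sixteen_sq
  set I : Ideal (𝓞 (CSField 16)) := J.map e with hI
  have hIJ : I.map (e.symm : 𝓞 (CSField 16) →+* AdjoinRoot (csPoly 16)) = J := by
    rw [hI]
    exact Ideal.map_of_equiv e (I := J)
  have hI0 : I ≠ ⊥ := by
    intro h0
    apply hJ
    rw [← hIJ, h0, Ideal.map_bot]
  have hImem : I ∈ (Ideal (𝓞 (CSField 16)))⁰ := mem_nonZeroDivisors_iff_ne_zero.mpr hI0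
  have hsymm : ∀ x, (e.symm : 𝓞 (CSField 16) →+* AdjoinRoot (csPoly 16)) (e x) = x :=
    fun x => e.symm_apply_apply x
  have hP3 : (span {(3 : 𝓞 (CSField 16)), thetaInt hθ - 2}).map
      (e.symm : 𝓞 (CSField 16) →+* AdjoinRoot (csPoly 16)) = csIdeal 2 3 16 := by
    rw [Ideal.map_span, Set.image_insert_eq, Set.image_singleton, map_sub, ← he, hsymm, map_ofNat,
      map_ofNat, csIdeal, Set.pair_comm]
    simp
  have hP7 : (span {(7 : 𝓞 (CSField 16)), thetaInt hθ - 4}).map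
      (e.symm : 𝓞 (CSField 16) →+* AdjoinRoot (csPoly 16)) = csIdeal 4 7 16 := by
    rw [Ideal.map_span, Set.image_insert_eq, Set.image_singleton, map_sub, ← he, hsymm, map_ofNat,
      map_ofNat, csIdeal, Set.pair_comm]
    simp
  have hcase : ∀ (P : Ideal (𝓞 (CSField 16))) (hP0 : P ∈ (Ideal (𝓞 (CSField 16)))⁰)
      (Q : Ideal (AdjoinRoot (csPoly 16))),
      P.map (e.symm : 𝓞 (CSField 16) →+* AdjoinRoot (csPoly 16)) = Q →
      ClassGroup.mk0 ⟨I, hImem⟩ = ClassGroup.mk0 ⟨P, hP0⟩ →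
        ∃ x y : AdjoinRoot (csPoly 16), x ≠ 0 ∧ y ≠ 0 ∧ span {x} * J = span {y} * Q := by
    intro P hP0 Q hPQ hcls
    obtain ⟨x, y, hx, hy, hxy⟩ := ClassGroup.mk0_eq_mk0_iff.mp hcls
    refine ⟨(e.symm : 𝓞 (CSField 16) →+* AdjoinRoot (csPoly 16)) x,
      (e.symm : 𝓞 (CSField 16) →+* AdjoinRoot (csPoly 16)) y,
      (map_ne_zero_iff _ e.symm.injective).mpr hx, (map_ne_zero_iff _ e.symm.injective).mpr hy, ?_⟩
    have h := congrArg (Ideal.map (e.symm : 𝓞 (CSField 16) →+* AdjoinRoot (csPoly 16))) hxy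
    simp only [Ideal.map_mul, Ideal.map_span, Set.image_singleton] at h
    rw [hIJ, hPQ] at h
    exact h
  rcases classGroup_mem_triple_sixteen hθ h3 (ClassGroup.mk0 ⟨I, hImem⟩) with h1 | h3' | h7
  · obtain ⟨z, hz⟩ := ((ClassGroup.mk0_eq_one_iff hImem).mp h1).principal
    have hz' : I = span {z} := by rw [hz, submodule_span_eq]
    have hz0 : z ≠ 0 := by
      rintro rfl
      apply hI0
      rw [hz', Ideal.span_singleton_eq_bot]
    refine ⟨1, (e.symm : 𝓞 (CSField 16) →+* AdjoinRoot (csPoly 16)) z, one_ne_zero,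
      (map_ne_zero_iff _ e.symm.injective).mpr hz0, Or.inl ?_⟩
    rw [Ideal.span_singleton_one, Ideal.top_mul, csIdeal_one_one, Ideal.mul_top, ← hIJ, hz',
      Ideal.map_span, Set.image_singleton]
  · obtain ⟨x, y, hx, hy, h⟩ := hcase _ _ _ hP3 h3'
    exact ⟨x, y, hx, hy, Or.inr (Or.inl h)⟩
  · obtain ⟨x, y, hx, hy, h⟩ := hcase _ _ _ hP7 h7
    exact ⟨x, y, hx, hy, Or.inr (Or.inr h)⟩

/-- `3 ∣ f₁₆(2) = -27`: `(2, 3, 16) ∈ 𝒞𝒮`. [cite: KimYamada2023, §6.1 (proof of Thm. B)] -/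
theorem three_dvd_eval_csPoly_sixteen_two : (3 : ℤ) ∣ (csPoly 16).eval 2 := by
  rw [eval_csPoly]; norm_num

/-- `7 ∣ f₁₆(4) = -133`: `(4, 7, 16) ∈ 𝒞𝒮`. [cite: KimYamada2023, §6.1 (proof of Thm. B)] -/
theorem seven_dvd_eval_csPoly_sixteen_four : (7 : ℤ) ∣ (csPoly 16).eval 4 := by
  rw [eval_csPoly]; norm_num

/-- **Every Cappell–Shaneson matrix of trace `16` is similar to `X_{1,1,16} = A₁₄`, `X_{2,3,16}` or
`X_{4,7,16}`** (Prop. 2.14). [cite: KimYamada2023, §6.1 (proof of Thm. B) and Prop. 2.14] -/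
theorem isConj_standardCSMatrix_of_trace_eq_sixteen (A : SL(3, ℤ))
    (hdet : ((A : Matrix (Fin 3) (Fin 3) ℤ) - 1).det = 1)
    (htr : Matrix.trace (A : Matrix (Fin 3) (Fin 3) ℤ) = 16) :
    IsConj A (standardCSMatrix 1 1 16 (one_dvd _)) ∨
      IsConj A (standardCSMatrix 2 3 16 three_dvd_eval_csPoly_sixteen_two) ∨
      IsConj A (standardCSMatrix 4 7 16 seven_dvd_eval_csPoly_sixteen_four) := by
  have hcover : ∀ J : Ideal (AdjoinRoot (csPoly 16)), J ≠ ⊥ →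
      ∃ (c d : ℤ) (_ : d ∣ (csPoly 16).eval c) (x y : AdjoinRoot (csPoly 16)),
        x ≠ 0 ∧ y ≠ 0 ∧ Ideal.span {x} * J = Ideal.span {y} * csIdeal c d 16 ∧
          ((c = 1 ∧ d = 1) ∨ (c = 2 ∧ d = 3) ∨ (c = 4 ∧ d = 7)) := by
    intro J hJ
    obtain ⟨x, y, hx, hy, hxy⟩ := ideal_class_adjoinRoot_sixteen J hJ
    rcases hxy with h1 | h3 | h7
    · exact ⟨1, 1, one_dvd _, x, y, hx, hy, h1, Or.inl ⟨rfl, rfl⟩⟩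
    · exact ⟨2, 3, three_dvd_eval_csPoly_sixteen_two, x, y, hx, hy, h3, Or.inr (Or.inl ⟨rfl, rfl⟩)⟩
    · exact ⟨4, 7, seven_dvd_eval_csPoly_sixteen_four, x, y, hx, hy, h7, Or.inr (Or.inr ⟨rfl, rfl⟩)⟩
  obtain ⟨c, d, h, hconj, hcd⟩ := exists_isConj_standardCSMatrix_of_cover _ hcover A hdet htr
  rcases hcd with ⟨rfl, rfl⟩ | ⟨rfl, rfl⟩ | ⟨rfl, rfl⟩
  · exact Or.inl hconj
  · exact Or.inr (Or.inl hconj)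
  · exact Or.inr (Or.inr hconj)

/-- **Kim–Yamada 2023, Theorem B for the trace `16`, PROVED**: the classes `(2, 3, 16)` and
`(4, 7, 16)` move by Gompf moves to the traces `10 = 16 - 2·3` and `9 = 16 - 7`, where Gompf's
conjecture holds. [cite: KimYamada2023, Thm. B and §6.1] -/
theorem gompfConjectureForTrace_sixteen : GompfConjectureForTrace 16 := by
  intro A hdet htr
  rcases isConj_standardCSMatrix_of_trace_eq_sixteen A hdet htr with h1 | h3 | h7
  · exact (GompfEquiv.of_isConj h1).trans (gompfEquiv_standardCSMatrix_one_one 14 (one_dvd _))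
  · exact (GompfEquiv.of_isConj h3).trans
      (gompfEquiv_standardCSMatrix_akbulutKirbyMatrix_of_modEq
        (gompfConjectureForTrace_ten_of aitchisonRubinstein1984_traceNegFiveClasses_holds)
        three_dvd_eval_csPoly_sixteen_two (show (16 : ℤ) ≡ 10 [ZMOD 3] by decide))
  · exact (GompfEquiv.of_isConj h7).trans
      (gompfEquiv_standardCSMatrix_akbulutKirbyMatrix_of_modEq
        (gompfConjectureForTrace_of_mem_Icc (by norm_num)) seven_dvd_eval_csPoly_sixteen_four
        (show (16 : ℤ) ≡ 9 [ZMOD 7] by decide))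

/-- **Theorem B for the trace `-11`** (`= 5 - 16`), by Theorem A. [cite: KimYamada2023, Thm. A and Thm. B] -/
theorem gompfConjectureForTrace_neg_eleven : GompfConjectureForTrace (-11) := by
  have h := gompfConjectureForTrace_of_five_sub gompfConjectureForTrace_sixteen
  norm_num at h
  exact h

end Matrices

end Literature.Topology.FourManifolds

end
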